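import Summits.BirchSwinnertonDyer.BirchSwinnertonDyer.Theorems.CumulativeHeegnerLeopoldtCumulativeHeegnerInclusionAtThreeCornutVatsalFamily
import Literature.NumberTheory.EllipticCurves.BurungaleKobayashiNakamuraOta2026.LocalBottomIndex
import HarnessLib

/-!
# Route `CumulativeHeegnerLeopoldt`, crux K1 `CumulativeHeegnerInclusionAtThree` (stmt-BirchSwinnertonDyer-24198),
# stub A (= crux stmt-26896): the CUMULATIVE Kummer tower `c♮_k = δ(z_{j₀} + … + z_k) ∈ S₃(E/K_k)` — temper exactly `1`,
# `𝒩_{k+1/k} c♮_{k+1} = res(3 · c♮_k)` — EXISTS on the Leopoldt cell (modulo Cornut–Vatsal), with non-torsion bottom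

Width prover bsd-line-chl-k1-p1-w2 g6, `--supports stmt-BirchSwinnertonDyer-24198`. THEOREMS ONLY (no definition, no named
fact, no `sorry`). The POSITIVE counterpart of the barrier file `…CornutVatsalFamily` (p641121): the crux text's first object —
«the cumulative class `y♮_m = Σ_{k≤m} y_{3^k}`, `Tr y♮_{m+1} = 3 y♮_m`, `κ♮ ∈ H¹ ⊗ ℚ₃` norm-compatible of temper 1» — in the
tree's compact-Selmer currency (`torsionH1Pi`, `IsKummerFamilyOver`, `conjPi`/`resPi`, `compactSelmerOver`), assembled as a
TOWER over all layers `k ≥ j₀` from LEAD g3's one-step lemma (`…TraceZero.sum_conjPi_cumulative_succ_eq_resPi_smul`, trace-ZERO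
form, p622174) and the torsion device of `…TraceZeroHeegnerModuleTorsion` §1 (p622685), and INSTANTIATED on the cell with the
Cornut–Vatsal family of `CornutVatsal2007.exists_heegnerFamily_traceTorsion_of_sq_dvd` (p640511) whose existence as an object is
the tree theorem `exists_heegnerFamily_Dt_eq_of_dvd_sq_sub` (p640007).

* §1 (any `p`, any Heegner family `F`, any `j₀`): `smul_cumulative_eq` (`Y_k := Σ_{j ∈ [j₀, k]} z_j ∈ E(K_k)`),
  `sum_smul_cumulative_succ` (`Tr_{K_{k+1}/K_k} Y_{k+1} = p·Y_k + Tr z_{k+1}`, points),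
  `sum_conjPi_eq_zero_of_isKummerFamilyOver_of_traceTorsion` (torsion trace + `E(K_∞)[p^∞] = 0` ⟹ the norm of `δ(z_{k+1})`
  vanishes), **`sum_conjPi_cumulative_eq_resPi_smul`** (`𝒩 c♮_{k+1} = res(p · c♮_k)` for the Kummer families of `Y_{k+1}`,
  `Y_k`, `k ≥ j₀`), **`exists_cumulativeKummerTower`** (∃ `(c♮_k)_k`, Kummer families of `(Y_k)_k`, all in `S_p(E/K_k)`, with
  that relation for every `k ≥ j₀`).
* §2 (the Leopoldt cell, `p = 3`): **`exists_cumulativeKummerTower_on_leopoldtCell`** — granted the CV fact, for every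
  anticyclotomic `κ`, generator `γ`, `Dt`, `β`, `jbar`: a Heegner family `F` tied to `(Dt, β)`, an index `j₀` and a tower
  `(c♮_k)_k` as in §1 with `𝒩 c♮_{k+1} = res(3·c♮_k)` for all `k ≥ j₀`, and `z_{j₀} = Y_{j₀}` of infinite order when `3 ∤ h_K`.
HONEST FRAMING: this is the RAW OBJECT of the research steps (b♮) receptacle / (c♮) reciprocity / (d♮) bound of A — a
`p`-power-norm-compatible (temper-1) family, NOT a norm-compatible one (that module is `⊥`, p641121); nothing about its
`Λ ⊗ 𝓗₁`-span, Coleman maps or `L`-values is claimed; A and K1 stay OPEN; BSD is not proved by any of this.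

References: [PerrinRiou1987BSMF] §3.4; [Howard2004HeegnerKolyvagin] §1, §3.3; Cornut–Vatsal 2007 (LMS LNS 320) Lemma 4.9 (iii),
Thm. 1.10.
-/

set_option autoImplicit false
-- `Summit.BirchSwinnertonDyer.BirchSwinnertonDyer.…`: the summit/problem path repeats by design (D-0017)
set_option linter.dupNamespace false

noncomputable section

open scoped Classical

open WeierstrassCurve Literature.NumberTheory.EllipticCurves Literature.NumberTheory.EllipticCurves.ModularForms

universe u

namespace Summit.BirchSwinnertonDyer.BirchSwinnertonDyer.Theorems.CumulativeHeegnerInclusionAtThreeCumulativeKummerTower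

open Summit.BirchSwinnertonDyer.BirchSwinnertonDyer.Theorems.CumulativeHeegnerInclusionAtThreeTraceZero

/-! ## §1 The cumulative points `Y_k = z_{j₀} + ⋯ + z_k` and their Kummer tower (any `p`) -/

section General

variable {K : Type u} [Field K] [NumberField K] {N : ℕ} [NeZero N] {W : WeierstrassCurve ℚ} [W.IsElliptic]
  {p : ℕ} [Fact p.Prime] {κ : ZpExtension K p} {γ : Field.absoluteGaloisGroup K} {jbar : AlgebraicClosure K →+* ℂ}

omit [W.IsElliptic] in
/-- **The cumulative point `Y_k = Σ_{j₀ ≤ j ≤ k} z_j` is `K_k`-rational**: each `z_j`, `j ≤ k`, is fixed by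
`Gal(K̄/K_j) ⊇ Gal(K̄/K_k)`. [cite: Howard2004HeegnerKolyvagin, §3.3 (H_k ⊆ E(K_k) ⊗ ℤ_p)] -/
theorem smul_cumulative_eq (F : HeegnerFamily N W K κ jbar) (j₀ k : ℕ) {τ : Field.absoluteGaloisGroup K}
    (hτ : τ ∈ κ.layerSubgroup k) : τ • (∑ j ∈ Finset.Icc j₀ k, F.z j) = ∑ j ∈ Finset.Icc j₀ k, F.z j := by
  rw [Finset.smul_sum]
  refine Finset.sum_congr rfl fun j hj ↦ ?_
  exact (F.isHeegnerNormPoint_z j).smul_eq_self (κ.layerSubgroup_antitone (Finset.mem_Icc.mp hj).2 hτ)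

omit [W.IsElliptic] in
/-- **The cumulative trace relation on points**: `Σ_{i<p} γ^{p^k i} • Y_{k+1} = p • Y_k + Σ_{i<p} γ^{p^k i} • z_{k+1}`
(`j₀ ≤ k + 1`): the `z_j`, `j ≤ k`, are fixed by `γ^{p^k i} ∈ Gal(K̄/K_k)`, so their trace is multiplication by `p` — the
point form of the crux text's «`Tr y♮_{m+1} = 3·y♮_m + Tr y_{3^{m+1}}`» (`…CumulativeClass.tr_cumulative_succ`, p617614).
[cite: PerrinRiou1987BSMF, §3.4 (traces in the tower)] -/
theorem sum_smul_cumulative_succ (hγ : κ.IsTopGenerator γ) (F : HeegnerFamily N W K κ jbar) {j₀ k : ℕ}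
    (hk : j₀ ≤ k + 1) :
    ∑ i ∈ Finset.range p, (γ ^ (p ^ k * i)) • (∑ j ∈ Finset.Icc j₀ (k + 1), F.z j) =
      (p : ℤ) • (∑ j ∈ Finset.Icc j₀ k, F.z j) + ∑ i ∈ Finset.range p, (γ ^ (p ^ k * i)) • F.z (k + 1) := by
  have hsplit : ∑ j ∈ Finset.Icc j₀ (k + 1), F.z j = (∑ j ∈ Finset.Icc j₀ k, F.z j) + F.z (k + 1) :=
    Finset.sum_Icc_succ_top hk _
  have hfix : ∀ i ∈ Finset.range p,
      (γ ^ (p ^ k * i)) • (∑ j ∈ Finset.Icc j₀ k, F.z j) = ∑ j ∈ Finset.Icc j₀ k, F.z j :=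
    fun i _ ↦ smul_cumulative_eq F j₀ k (zpExtension_pow_pow_mul_mem_layerSubgroup p κ hγ k i)
  simp_rw [hsplit, smul_add, Finset.sum_add_distrib]
  rw [Finset.sum_congr rfl hfix, Finset.sum_const, Finset.card_range, natCast_zsmul]

/-- **The norm of the Kummer family of a torsion-trace norm point vanishes** (torsion form of LEAD g3's
`sum_conjPi_eq_zero_of_isKummerFamilyOver_of_traceZero`): if `E(K_∞)[p^∞] = 0`, `m • Tr_{K_{k+1}/K_k} z_{k+1} = 0` with
`m ≠ 0`, and `d` is the Kummer family of `z_{k+1}` over `K_{k+1}`, then `Σ_{i<p} conj_{γ^{p^k i}} d = 0` — it is the Kummer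
family of the (torsion, hence Kummer-trivial: `kummerFamily_eq_zero_of_torsion_of_fixedPoints_eq_bot`) trace.
[cite: Howard2004HeegnerKolyvagin, §1 (the compact Kummer map is Gal-equivariant)] -/
theorem sum_conjPi_eq_zero_of_isKummerFamilyOver_of_traceTorsion
    (hbot : FixedPoints.addSubgroup κ.kerSubgroup ((W.baseChange K).geomPrimaryTorsion p) = ⊥)
    (F : HeegnerFamily N W K κ jbar) (k : ℕ) {m : ℤ} (hm0 : m ≠ 0)
    (hmt : m • (∑ i ∈ Finset.range p, (γ ^ (p ^ k * i)) • F.z (k + 1)) = 0)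
    {d : (W.baseChange K).torsionH1Pi p (κ.layerSubgroup (k + 1))}
    (hd : (W.baseChange K).IsKummerFamilyOver p (κ.layerSubgroup (k + 1))
      (fun _ hσ ↦ (F.isHeegnerNormPoint_z (k + 1)).smul_eq_self hσ) d) :
    ∑ i ∈ Finset.range p, (W.baseChange K).conjPi p (κ.layerSubgroup (k + 1)) (γ ^ (p ^ k * i)) d = 0 := by
  have hfix : ∀ (i : ℕ), ∀ τ ∈ κ.layerSubgroup (k + 1),
      τ • ((γ ^ (p ^ k * i)) • F.z (k + 1)) = (γ ^ (p ^ k * i)) • F.z (k + 1) := by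
    intro i τ hτ
    rw [← mul_smul, show τ * γ ^ (p ^ k * i) = γ ^ (p ^ k * i) * ((γ ^ (p ^ k * i))⁻¹ * τ * γ ^ (p ^ k * i))
      by group, mul_smul, (F.isHeegnerNormPoint_z (k + 1)).smul_eq_self
      (conj_mem_of_normal (κ.layerSubgroup (k + 1)) (γ ^ (p ^ k * i)) ⟨τ, hτ⟩)]
  have hsum := IsKummerFamilyOver.sum (p := p) (Finset.range p)
    (P := fun i ↦ (γ ^ (p ^ k * i)) • F.z (k + 1))
    (d := fun i ↦ (W.baseChange K).conjPi p (κ.layerSubgroup (k + 1)) (γ ^ (p ^ k * i)) d)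
    (hP := hfix) (fun i ↦ hd.conjPi (γ ^ (p ^ k * i)))
  exact kummerFamily_eq_zero_of_torsion_of_fixedPoints_eq_bot hbot hm0 hmt
    (IsKummerFamilyOver.of_eq rfl (hP' := fun _ hτ ↦ smul_trace_z_eq F k hτ) hsum)

/-- **The cumulative Kummer tower has temper exactly `1`: `𝒩_{K_{k+1}/K_k} c♮_{k+1} = res_{k→k+1}(p · c♮_k)`.** Let `c♮_k`,
`c♮_{k+1}` be the Kummer families of the cumulative points `Y_k = Σ_{j₀≤j≤k} z_j ∈ E(K_k)` and `Y_{k+1} ∈ E(K_{k+1})`,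
`j₀ ≤ k + 1`; assume `E(K_∞)[p^∞] = 0` and that the trace `Tr_{K_{k+1}/K_k} z_{k+1}` is TORSION. Then
`Σ_{i<p} conj_{γ^{p^k i}} c♮_{k+1} = res(p • c♮_k)`: by uniqueness of Kummer families `c♮_{k+1} = res c♮_k + δ(z_{k+1})`,
the norm of `res c♮_k` is `res(p·c♮_k)` (`sum_conjPi_resPi_eq_resPi_smul`) and the norm of `δ(z_{k+1})` is `0`.
[cite: PerrinRiou1987BSMF, §3.4 (ℋ_n and traces)] [cite: Howard2004HeegnerKolyvagin, §3.3 (H_k)] -/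
theorem sum_conjPi_cumulative_eq_resPi_smul (hγ : κ.IsTopGenerator γ)
    (hbot : FixedPoints.addSubgroup κ.kerSubgroup ((W.baseChange K).geomPrimaryTorsion p) = ⊥)
    (F : HeegnerFamily N W K κ jbar) {j₀ k : ℕ} (hk : j₀ ≤ k + 1) {m : ℤ} (hm0 : m ≠ 0)
    (hmt : m • (∑ i ∈ Finset.range p, (γ ^ (p ^ k * i)) • F.z (k + 1)) = 0)
    {c : (W.baseChange K).torsionH1Pi p (κ.layerSubgroup k)}
    (hc : (W.baseChange K).IsKummerFamilyOver p (κ.layerSubgroup k)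
      (P := ∑ j ∈ Finset.Icc j₀ k, F.z j) (fun _ hσ ↦ smul_cumulative_eq F j₀ k hσ) c)
    {c' : (W.baseChange K).torsionH1Pi p (κ.layerSubgroup (k + 1))}
    (hc' : (W.baseChange K).IsKummerFamilyOver p (κ.layerSubgroup (k + 1))
      (P := ∑ j ∈ Finset.Icc j₀ (k + 1), F.z j) (fun _ hσ ↦ smul_cumulative_eq F j₀ (k + 1) hσ) c') :
    ∑ i ∈ Finset.range p, (W.baseChange K).conjPi p (κ.layerSubgroup (k + 1)) (γ ^ (p ^ k * i)) c' =
      (W.baseChange K).resPi p (κ.layerSubgroup_antitone (Nat.le_succ k)) ((p : ℤ) • c) := by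
  -- a Kummer family `d` of `z_{k+1}` over `K_{k+1}`; then `res c + d` is a Kummer family of `Y_k + z_{k+1} = Y_{k+1}`
  obtain ⟨d, hd⟩ := (W.baseChange K).exists_isKummerFamilyOver p (κ.layerSubgroup (k + 1)) (F.z (k + 1))
    (fun _ hσ ↦ (F.isHeegnerNormPoint_z (k + 1)).smul_eq_self hσ)
  have hres := hc.resPi (κ.layerSubgroup_antitone (Nat.le_succ k))
  have hadd := IsKummerFamilyOver.add p hres hd
  have hsplit : (∑ j ∈ Finset.Icc j₀ k, F.z j) + F.z (k + 1) = ∑ j ∈ Finset.Icc j₀ (k + 1), F.z j :=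
    (Finset.sum_Icc_succ_top hk _).symm
  have heq : c' = (W.baseChange K).resPi p (κ.layerSubgroup_antitone (Nat.le_succ k)) c + d :=
    IsKummerFamilyOver.unique p hc' (IsKummerFamilyOver.of_eq hsplit hadd)
  rw [heq, sum_conjPi_add, sum_conjPi_resPi_eq_resPi_smul hγ k c,
    sum_conjPi_eq_zero_of_isKummerFamilyOver_of_traceTorsion hbot F k hm0 hmt hd, add_zero]

/-- **The cumulative Kummer tower exists** (any prime `p`, any Heegner family `F`, any starting layer `j₀`): there are
compact Selmer elements `c♮_k ∈ S_p(E/K_k) ⊆ ∏_m H¹(K_k, E[p^m])`, `c♮_k` = the Kummer family of `Y_k = Σ_{j₀≤j≤k} z_j`,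
such that — if `E(K_∞)[p^∞] = 0` and the traces `Tr_{K_{j+1}/K_j} z_{j+1}`, `j ≥ j₀`, are torsion —
`Σ_{i<p} conj_{γ^{p^k i}} c♮_{k+1} = res(p • c♮_k)` for every `k ≥ j₀` (temper exactly `1`).
[cite: PerrinRiou1987BSMF, §3.4] [cite: Howard2004HeegnerKolyvagin, §1 and §3.3] -/
theorem exists_cumulativeKummerTower (hγ : κ.IsTopGenerator γ)
    (hbot : FixedPoints.addSubgroup κ.kerSubgroup ((W.baseChange K).geomPrimaryTorsion p) = ⊥)
    (F : HeegnerFamily N W K κ jbar) (j₀ : ℕ)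
    (hTT : ∀ j, j₀ ≤ j → ∃ m : ℤ, m ≠ 0 ∧ m • (∑ i ∈ Finset.range p, (γ ^ (p ^ j * i)) • F.z (j + 1)) = 0) :
    ∃ c : (k : ℕ) → (W.baseChange K).torsionH1Pi p (κ.layerSubgroup k),
      (∀ k, (W.baseChange K).IsKummerFamilyOver p (κ.layerSubgroup k)
        (P := ∑ j ∈ Finset.Icc j₀ k, F.z j) (fun _ hσ ↦ smul_cumulative_eq F j₀ k hσ) (c k)) ∧
      (∀ k, c k ∈ (W.baseChange K).compactSelmerOver (κ.layerSubgroup k) p) ∧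
      (∀ k, j₀ ≤ k →
        ∑ i ∈ Finset.range p, (W.baseChange K).conjPi p (κ.layerSubgroup (k + 1)) (γ ^ (p ^ k * i)) (c (k + 1)) =
          (W.baseChange K).resPi p (κ.layerSubgroup_antitone (Nat.le_succ k)) ((p : ℤ) • c k)) := by
  choose c hc using fun k ↦ (W.baseChange K).exists_isKummerFamilyOver p (κ.layerSubgroup k)
    (∑ j ∈ Finset.Icc j₀ k, F.z j) (fun _ hσ ↦ smul_cumulative_eq F j₀ k hσ)
  refine ⟨c, hc, fun k ↦ (hc k).mem_compactSelmerOver, fun k hk ↦ ?_⟩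
  obtain ⟨m, hm0, hmt⟩ := hTT k hk
  exact sum_conjPi_cumulative_eq_resPi_smul hγ hbot F (Nat.le_succ_of_le hk) hm0 hmt (hc k) (hc (k + 1))

end General

/-! ## §2 The cumulative tower on the Leopoldt cell (`p = 3`), modulo Cornut–Vatsal -/

section Cell

variable {K : Type} [Field K] [NumberField K] {W : WeierstrassCurve ℚ} [W.IsElliptic] [W.IsGloballyMinimal]
  {N : ℕ} [NeZero N]

/-- **THE CUMULATIVE KUMMER TOWER ON THE LEOPOLDT CELL.** On the cell of crux K1 / A (`ClassO6 W 3`, non-anomalous rational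
line, `N = N_E`, `K` imaginary quadratic Heegner for `N`), granted the named fact
`CornutVatsal2007.exists_heegnerFamily_traceTorsion_of_sq_dvd`: for every ANTICYCLOTOMIC `ℤ₃`-extension `κ` with generator
`γ`, every `Dt`, `β`, `jbar`, there are a Heegner family `F` tied to `(Dt, β)`, an index `j₀` and compact Selmer elements
`c♮_k ∈ S₃(E/K_k)` — the Kummer families of the CUMULATIVE points `Y_k = z_{j₀} + ⋯ + z_k` — with
`Σ_{i<3} conj_{γ^{3^k i}} c♮_{k+1} = res(3 • c♮_k)` for all `k ≥ j₀` (temper exactly `1`; the torsion input `E(K_∞)[3^∞] = 0`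
is the cell theorem p615628), and, when `3 ∤ h_K`, a bottom point `Y_{j₀} = z_{j₀}` of INFINITE order. This is the raw
object behind the crux text's `κ♮`; its receptacle (b♮), reciprocity (c♮) and Kolyvagin bound (d♮) remain research.
CONDITIONAL on the one named fact. [cite: CornutVatsal2007, Lemma 4.9 (iii) and Thm. 1.10]
[cite: PerrinRiou1987BSMF, §3.4] [cite: Howard2004HeegnerKolyvagin, §3.3] -/
theorem exists_cumulativeKummerTower_on_leopoldtCell
    (hCV : CornutVatsal2007.exists_heegnerFamily_traceTorsion_of_sq_dvd)
    (hO6 : Summit.BirchSwinnertonDyer.Rank1Residual.Additive.ClassO6 W 3)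
    (hline : ∃ Φ : AddSubgroup (WeierstrassCurve.geomTorsion W ((3 : ℕ) : ℤ)),
        Literature.NumberTheory.EllipticCurves.Rank1Residual.IsRationalLine W 3 Φ ∧
        ∀ (v : IsDedekindDomain.HeightOneSpectrum (NumberField.RingOfIntegers ℚ)),
          ((3 : ℕ) : NumberField.RingOfIntegers ℚ) ∈ v.asIdeal → ∀ 𝔓 ∈ v.primesAbove,
          ¬ (∀ g ∈ 𝔓.decompositionSubgroup (Field.absoluteGaloisGroup ℚ), ∀ P ∈ Φ, g • P = P) ∧
          ¬ (∀ g ∈ 𝔓.decompositionSubgroup (Field.absoluteGaloisGroup ℚ),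
              ∀ P : WeierstrassCurve.geomTorsion W ((3 : ℕ) : ℤ), g • P - P ∈ Φ))
    (hN : W.conductorNorm ℤ = N) (hK : IsImaginaryQuadratic K) (hHg : SatisfiesHeegnerHypothesis N K)
    (κ : ZpExtension K 3) (hκ : κ.IsAnticyclotomic) (γ : Field.absoluteGaloisGroup K) (hγ : κ.IsTopGenerator γ)
    (Dt : ModularParametrizationData W N) {β : ℤ} (hβ : (4 * N : ℤ) ∣ β ^ 2 - NumberField.discr K)
    (jbar : AlgebraicClosure K →+* ℂ) :
    ∃ (F : HeegnerFamily N W K κ jbar) (j₀ : ℕ) (c : (k : ℕ) → (W.baseChange K).torsionH1Pi 3 (κ.layerSubgroup k)),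
      F.Dt = Dt ∧ F.β = β ∧
      (∀ k, (W.baseChange K).IsKummerFamilyOver 3 (κ.layerSubgroup k)
        (P := ∑ j ∈ Finset.Icc j₀ k, F.z j) (fun _ hσ ↦ smul_cumulative_eq F j₀ k hσ) (c k)) ∧
      (∀ k, c k ∈ (W.baseChange K).compactSelmerOver (κ.layerSubgroup k) 3) ∧
      (∀ k, j₀ ≤ k →
        ∑ i ∈ Finset.range 3, (W.baseChange K).conjPi 3 (κ.layerSubgroup (k + 1)) (γ ^ (3 ^ k * i)) (c (k + 1)) =
          (W.baseChange K).resPi 3 (κ.layerSubgroup_antitone (Nat.le_succ k)) ((3 : ℤ) • c k)) ∧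
      (¬ 3 ∣ NumberField.classNumber K → ¬ IsOfFinAddOrder (∑ j ∈ Finset.Icc j₀ j₀, F.z j)) := by
  have h9 : 3 ^ 2 ∣ N := by
    rw [← hN]; exact CumulativeHeegnerInclusionAtThreeCornutVatsalFamily.sq_dvd_conductorNorm_of_addv_three W hO6.2.1
  obtain ⟨F, j₀, hDt, hβ', hTT, hNT⟩ := hCV N W K hK hHg 3 (by norm_num) h9 hN κ hκ γ hγ Dt β hβ jbar
  have hbot := CumulativeHeegnerInclusionAtThreeCellNoThreeTorsion.cell_fixedPoints_kerSubgroup_eq_bot W N K hO6 hline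
    hN hK hHg κ
  obtain ⟨c, hc, hS, hrel⟩ := exists_cumulativeKummerTower hγ hbot F j₀ hTT
  refine ⟨F, j₀, c, hDt, hβ', hc, hS, hrel, fun hh ↦ ?_⟩
  rw [Finset.Icc_self, Finset.sum_singleton]
  exact hNT hh j₀ le_rfl

end Cell

end Summit.BirchSwinnertonDyer.BirchSwinnertonDyer.Theorems.CumulativeHeegnerInclusionAtThreeCumulativeKummerTower

end
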